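import Literature.MathematicalPhysics.QuantumLattice.FreeFermiGasNoPairFieldLRO
import Literature.MathematicalPhysics.QuantumLattice.PairFieldMomentum

/-!
# Crux `WindowGap` (stmt-HubbardSuperconductivity-1088), negative side: pair modes at nonzero PAIR
# MOMENTUM against occupation-diagonal weights (the flat pair structure factor of free fermions)

Support lemmas for the `U = 0` calibration of the crux `KacWindowPenalty.WindowGap`
(`Theorems/WindowGap/Negative/FreeWindowCalibration.lean`, which consumes the last theorem here).
The tree's `FreeFermiGasNoPairFieldLRO.lean` treats the ZERO-momentum pair field
`Δ_d = Δ_d(0)`; the Kac window of the crux needs every pair momentum `m`: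

* `sum_conj_torusChar_smul_annihilation_mul_annihilation`, `pairFieldAt_eq_neg_sum_smul_pairModeAt`
  — Fourier expansion of the pair field at pair momentum `m`:
  `Δ_g(m) = Σ_x e^{−iq_m·x} P_x = −Σ_k A_m(k) • c_{(m−k)↓} c_{k↑}`,
  `A_m(k) = Σ_e (g e/√2)(χ_{m−k}(e) + χ_k(e))` (the `m = 0` case is the tree's
  `pairField_eq_neg_sum_pairFieldMode_smul_pairMode`).
* `conjTranspose_pairModeAt_mul_self`, `trace_mul_conjTranspose_pairModeAt_mul_pairModeAt_of_ne`,
  `trace_mul_conjTranspose_sum_smul_pairModeAt_mul` — the diagonal-ensemble selection rule ("Wick's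
  rule" for occupation-diagonal weights, basis-free) at pair momentum `m`: against any `P` commuting
  with the Bloch occupation numbers `n_{k↑}`, `tr (P B_m(k)† B_m(k')) = δ_{kk'} tr (P n_{k↑} n_{(m−k)↓})`,
  `B_m(k) = c_{(m−k)↓} c_{k↑}`.
* `re_trace_mul_conjTranspose_pairFieldAt_dWave_mul_le` — for a Hermitian idempotent `P` commuting
  with every `n_{kσ}` and EVERY `m`: `Re tr (P Δ_d(m)ᴴ Δ_d(m)) ≤ 50 · L² · Re tr P`
  (`|A_m(k)|² ≤ 50`, `0 ≤ tr (P n_{k↑} n_{(m−k)↓}) ≤ tr P`): the pair structure factor of an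
  occupation-diagonal state is flat, `O(1)` per mode at every pair momentum.

Sources: J. Bardeen, L. N. Cooper, J. R. Schrieffer, Phys. Rev. 108 (1957) 1175, §II; C. N. Yang,
Rev. Mod. Phys. 34 (1962) 694, §3; D. J. Scalapino, Phys. Rep. 250 (1995) 329, §2; J. von Delft,
D. C. Ralph, Phys. Rep. 345 (2001) 61, §4.2.3. Folklore finite-dimensional statements; no named
facts, no definitions.
-/

set_option linter.dupNamespace false

noncomputable section

namespace Summit.HubbardSuperconductivity.HubbardSuperconductivity.Theorems.WindowGap.Negative

open Matrix Finset Literature.MathematicalPhysics.QuantumLattice Literature.Probability.LatticeModels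
open scoped ComplexOrder ComplexConjugate

variable {L : ℕ} [NeZero L]

/-! ### Fourier expansion of the pair field at pair momentum `m` -/

/-- **A pair of fields at fixed separation and total momentum `m`**:
`Σ_x conj χ_m(x) • c_{xσ} c_{(x+e)τ} = Σ_k χ_{m−k}(e) • c_{kσ} c_{(m−k)τ}` (Fourier inversion in both
fields, orthogonality of characters). Bardeen–Cooper–Schrieffer (1957) §II. [folklore] -/
theorem sum_conj_torusChar_smul_annihilation_mul_annihilation (m e : TorusSite 2 L) (σ τ : Fin 2) :
    ∑ x : TorusSite 2 L, conj (torusChar m x) •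
        (annihilation (orb (FermionTorus.ofTorusSite x) σ) *
          annihilation (orb (FermionTorus.ofTorusSite (x + e)) τ)) =
      ∑ k : TorusSite 2 L, torusChar (m - k) e •
        (momentumAnnihilation k σ * momentumAnnihilation (m - k) τ) := by
  classical
  simp_rw [annihilation_orb_eq_sum_momentumAnnihilation, FermionTorus.toTorusSite_ofTorusSite,
    Finset.sum_mul_sum, smul_mul_smul_comm, Finset.smul_sum, smul_smul]
  rw [Finset.sum_comm]
  refine Finset.sum_congr rfl fun k _ => ?_
  rw [Finset.sum_comm]
  simp_rw [← Finset.sum_smul]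
  have hcoef : ∀ l : TorusSite 2 L,
      ∑ x : TorusSite 2 L, conj (torusChar m x) * (torusFourierWeight 2 L * torusChar k x *
        (torusFourierWeight 2 L * torusChar l (x + e))) =
        if l = m - k then torusChar (m - k) e else 0 := by
    intro l
    have : ∀ x : TorusSite 2 L, conj (torusChar m x) * (torusFourierWeight 2 L * torusChar k x *
        (torusFourierWeight 2 L * torusChar l (x + e))) =
        torusFourierWeight 2 L * torusFourierWeight 2 L * torusChar l e * torusChar (k + l + -m) x := by
      intro x
      rw [torusChar_add_right, ← torusChar_neg_left, ← torusChar_mul_torusChar_left,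
        ← torusChar_mul_torusChar_left]
      ring
    simp_rw [this]
    rw [← Finset.mul_sum, sum_torusChar_right]
    by_cases hkl : l = m - k
    · subst hkl
      rw [if_pos (by abel), if_pos rfl]
      linear_combination torusChar (m - k) e * torusFourierWeight_mul_self_mul_pow (d := 2) (L := L)
    · rw [if_neg (fun h => hkl ?_), if_neg hkl, mul_zero]
      have h' : l = m - k := by
        have := congrArg (· + (m - k)) h
        simp only [zero_add] at this
        rw [← this]; abel
      exact h'
  simp_rw [hcoef, ite_smul, zero_smul]
  rw [Finset.sum_ite_eq']
  simp

/-- **The pair field at pair momentum `m` is a weighted sum of pair modes**: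
`Δ_g(m) = −Σ_k A_m(k) • c_{(m−k)↓} c_{k↑}` with
`A_m(k) = Σ_{e ∈ {0} ∪ unitSteps} (g e/√2) (χ_{m−k}(e) + χ_k(e))` (Fourier expansion of the local
singlet pairs `c_{x↑}c_{x+e,↓} − c_{x↓}c_{x+e,↑}` against `conj χ_m(x)`; at `m = 0` this is
`pairField_eq_neg_sum_pairFieldMode_smul_pairMode`). Scalapino, Phys. Rep. 250 (1995) 329, §2;
Bardeen–Cooper–Schrieffer (1957) §II. [folklore] -/
theorem pairFieldAt_eq_neg_sum_smul_pairModeAt (g : Site 2 → ℝ) (m : TorusSite 2 L) :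
    pairFieldAt g L m = -∑ k : TorusSite 2 L,
      (∑ e ∈ insert 0 unitSteps, ((g e / Real.sqrt 2 : ℝ) : ℂ) *
        (torusChar (m - k) (Torus.proj L e) + torusChar k (Torus.proj L e))) •
        (momentumAnnihilation (m - k) 1 * momentumAnnihilation k 0) := by
  classical
  have hA : ∀ e : TorusSite 2 L, ∑ x : TorusSite 2 L, conj (torusChar m x) •
      (annihilation (orb (FermionTorus.ofTorusSite x) 0) *
        annihilation (orb (FermionTorus.ofTorusSite (x + e)) 1)) =
      -∑ k : TorusSite 2 L, torusChar (m - k) e •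
        (momentumAnnihilation (m - k) 1 * momentumAnnihilation k 0) := by
    intro e
    rw [sum_conj_torusChar_smul_annihilation_mul_annihilation, ← Finset.sum_neg_distrib]
    refine Finset.sum_congr rfl fun k _ => ?_
    rw [momentumAnnihilation_mul_eq_neg, smul_neg]
  have hB : ∀ e : TorusSite 2 L, ∑ x : TorusSite 2 L, conj (torusChar m x) •
      (annihilation (orb (FermionTorus.ofTorusSite x) 1) *
        annihilation (orb (FermionTorus.ofTorusSite (x + e)) 0)) =
      ∑ k : TorusSite 2 L, torusChar k e •
        (momentumAnnihilation (m - k) 1 * momentumAnnihilation k 0) := by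
    intro e
    rw [sum_conj_torusChar_smul_annihilation_mul_annihilation,
      ← Equiv.sum_comp (Equiv.subLeft m)]
    refine Finset.sum_congr rfl fun k _ => ?_
    simp only [Equiv.subLeft_apply, sub_sub_cancel]
  rw [pairFieldAt_eq_sum_torusChar]
  unfold localPair
  have hcomm : ∀ (x : TorusSite 2 L) (e : Site 2)
      (X : Matrix (Finset (Orb (FermionTorus 2 L))) (Finset (Orb (FermionTorus 2 L))) ℂ),
      conj (torusChar m x) • (((g e / Real.sqrt 2 : ℝ) : ℂ) • X) =
        ((g e / Real.sqrt 2 : ℝ) : ℂ) • (conj (torusChar m x) • X) := fun x e X => smul_comm _ _ _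
  simp_rw [Finset.smul_sum, hcomm]
  rw [Finset.sum_comm]
  simp_rw [← Finset.smul_sum, smul_sub, Finset.sum_sub_distrib, hA, hB]
  have hk : ∀ e : Site 2, ((g e / Real.sqrt 2 : ℝ) : ℂ) •
      (-∑ k : TorusSite 2 L, torusChar (m - k) (Torus.proj L e) •
          (momentumAnnihilation (m - k) 1 * momentumAnnihilation k 0) -
        ∑ k : TorusSite 2 L, torusChar k (Torus.proj L e) •
          (momentumAnnihilation (m - k) 1 * momentumAnnihilation k 0)) =
      -∑ k : TorusSite 2 L, (((g e / Real.sqrt 2 : ℝ) : ℂ) *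
        (torusChar (m - k) (Torus.proj L e) + torusChar k (Torus.proj L e))) •
          (momentumAnnihilation (m - k) 1 * momentumAnnihilation k 0) := by
    intro e
    rw [← neg_add', ← Finset.sum_add_distrib, smul_neg, Finset.smul_sum]
    simp_rw [← add_smul, smul_smul]
  simp_rw [hk]
  rw [Finset.sum_neg_distrib, Finset.sum_comm]
  simp_rw [← Finset.sum_smul]

/-! ### Pair modes at pair momentum `m` against occupation-diagonal weights -/

/-- **`B_m(k)† B_m(k) = n_{k↑} n_{(m−k)↓}`** for the pair mode `B_m(k) = c_{(m−k)↓} c_{k↑}` (the two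
modes differ by their spin). von Delft–Ralph (2001) §4.2.3. [folklore] -/
theorem conjTranspose_pairModeAt_mul_self (m k : TorusSite 2 L) :
    (momentumAnnihilation (m - k) 1 * momentumAnnihilation k 0)ᴴ *
        (momentumAnnihilation (m - k) 1 * momentumAnnihilation k 0) =
      momentumNumber k 0 * momentumNumber (m - k) 1 := by
  have h : ¬ (m - k = k ∧ (1 : Fin 2) = 0) := fun h => absurd h.2 (by decide)
  rw [conjTranspose_mul, momentumAnnihilation_conjTranspose, momentumAnnihilation_conjTranspose,
    Matrix.mul_assoc, ← Matrix.mul_assoc (momentumCreation (m - k) 1), ← momentumNumber,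
    momentumNumber_mul_momentumAnnihilation_of_ne h, ← Matrix.mul_assoc, ← momentumNumber]

/-- **Diagonal-ensemble selection rule at pair momentum `m`.** If `P` commutes with `n_{k'↑}` then
`tr (P B_m(k)† B_m(k')) = 0` for `k ≠ k'` (insert `c_{k'↑} = c_{k'↑} n_{k'↑}`, cycle `n_{k'↑}`
through `P`, commute it through the three foreign modes, `n_{k'↑} c_{k'↑} = 0`).
Bardeen–Cooper–Schrieffer (1957) §II; Yang (1962) §3. [folklore] -/
theorem trace_mul_conjTranspose_pairModeAt_mul_pairModeAt_of_ne
    {P : Matrix (Finset (Orb (FermionTorus 2 L))) (Finset (Orb (FermionTorus 2 L))) ℂ}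
    (m : TorusSite 2 L) {k k' : TorusSite 2 L} (hk : k ≠ k') (hP : Commute P (momentumNumber k' 0)) :
    (P * ((momentumAnnihilation (m - k) 1 * momentumAnnihilation k 0)ᴴ *
      (momentumAnnihilation (m - k') 1 * momentumAnnihilation k' 0))).trace = 0 := by
  have h1 : ¬ (k' = k ∧ (0 : Fin 2) = 0) := fun h => hk h.1.symm
  have h2 : ¬ (k' = m - k ∧ (0 : Fin 2) = 1) := fun h => absurd h.2 (by decide)
  have h3 : ¬ (k' = m - k' ∧ (0 : Fin 2) = 1) := fun h => absurd h.2 (by decide)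
  have hnY : momentumNumber k' 0 *
        (momentumCreation k 0 * momentumCreation (m - k) 1 * momentumAnnihilation (m - k') 1) =
      momentumCreation k 0 * momentumCreation (m - k) 1 * momentumAnnihilation (m - k') 1 *
        momentumNumber k' 0 := by
    rw [← Matrix.mul_assoc, ← Matrix.mul_assoc, momentumNumber_mul_momentumCreation_of_ne h1,
      Matrix.mul_assoc (momentumCreation k 0), momentumNumber_mul_momentumCreation_of_ne h2,
      ← Matrix.mul_assoc, Matrix.mul_assoc _ (momentumNumber k' 0),
      momentumNumber_mul_momentumAnnihilation_of_ne h3, ← Matrix.mul_assoc]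
  have hX : (momentumAnnihilation (m - k) 1 * momentumAnnihilation k 0)ᴴ *
      (momentumAnnihilation (m - k') 1 * momentumAnnihilation k' 0) =
      momentumCreation k 0 * momentumCreation (m - k) 1 * momentumAnnihilation (m - k') 1 *
        (momentumAnnihilation k' 0 * momentumNumber k' 0) := by
    rw [momentumAnnihilation_mul_momentumNumber_self, conjTranspose_mul,
      momentumAnnihilation_conjTranspose, momentumAnnihilation_conjTranspose]
    simp only [Matrix.mul_assoc]
  calc (P * ((momentumAnnihilation (m - k) 1 * momentumAnnihilation k 0)ᴴ *
        (momentumAnnihilation (m - k') 1 * momentumAnnihilation k' 0))).trace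
      = (P * (momentumCreation k 0 * momentumCreation (m - k) 1 * momentumAnnihilation (m - k') 1 *
          momentumAnnihilation k' 0) * momentumNumber k' 0).trace := by
        rw [hX]; simp only [Matrix.mul_assoc]
    _ = (momentumNumber k' 0 * (P * (momentumCreation k 0 * momentumCreation (m - k) 1 *
          momentumAnnihilation (m - k') 1 * momentumAnnihilation k' 0))).trace := Matrix.trace_mul_comm _ _
    _ = (P * (momentumCreation k 0 * momentumCreation (m - k) 1 * momentumAnnihilation (m - k') 1 *
          (momentumNumber k' 0 * momentumAnnihilation k' 0))).trace := by
        rw [← Matrix.mul_assoc (momentumNumber k' 0) P, ← hP.eq, Matrix.mul_assoc P,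
          ← Matrix.mul_assoc (momentumNumber k' 0), hnY, Matrix.mul_assoc _ (momentumNumber k' 0)]
    _ = 0 := by
        rw [momentumNumber_mul_momentumAnnihilation_self, Matrix.mul_zero, Matrix.mul_zero,
          trace_zero]

/-- `0 ≤ Re tr (P n_{k↑} n_{k'↓}) ≤ Re tr P` for a Hermitian idempotent `P` commuting with `n_{k↑}`
and `n_{k'↓}` (three commuting orthogonal projections). [folklore] -/
theorem re_trace_mul_momentumNumber_up_mul_momentumNumber_down_mem_Icc
    {P : Matrix (Finset (Orb (FermionTorus 2 L))) (Finset (Orb (FermionTorus 2 L))) ℂ}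
    (hPh : Pᴴ = P) (hPP : P * P = P) (k k' : TorusSite 2 L)
    (h0 : Commute P (momentumNumber k 0)) (h1 : Commute P (momentumNumber k' 1)) :
    (P * (momentumNumber k 0 * momentumNumber k' 1)).trace.re ∈ Set.Icc 0 P.trace.re := by
  have hA : (momentumNumber k 0 * momentumNumber k' 1)ᴴ = momentumNumber k 0 * momentumNumber k' 1 := by
    rw [conjTranspose_mul, momentumNumber_conjTranspose, momentumNumber_conjTranspose]
    exact (momentumNumber_commute _ _ _ _).eq
  have hAA : momentumNumber k 0 * momentumNumber k' 1 * (momentumNumber k 0 * momentumNumber k' 1) =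
      momentumNumber k 0 * momentumNumber k' 1 := by
    rw [Matrix.mul_assoc, ← Matrix.mul_assoc (momentumNumber k' 1) (momentumNumber k 0),
      (momentumNumber_commute k' k 1 0).eq, Matrix.mul_assoc, momentumNumber_mul_self,
      ← Matrix.mul_assoc, momentumNumber_mul_self]
  have hc : Commute P (momentumNumber k 0 * momentumNumber k' 1) := h0.mul_right h1
  exact ⟨re_trace_mul_nonneg_of_commute hPh hPP hA hAA hc,
    re_trace_mul_le_of_commute hPh hPP hA hAA hc⟩

/-- **"Wick's rule" at pair momentum `m` for occupation-diagonal weights.** For complex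
coefficients `A` and `P` commuting with every `n_{k↑}`,
`tr (P (Σ_k A(k) B_m(k))† (Σ_k A(k) B_m(k))) = Σ_k |A(k)|² tr (P n_{k↑} n_{(m−k)↓})`.
Bardeen–Cooper–Schrieffer (1957) §II. [folklore] -/
theorem trace_mul_conjTranspose_sum_smul_pairModeAt_mul
    {P : Matrix (Finset (Orb (FermionTorus 2 L))) (Finset (Orb (FermionTorus 2 L))) ℂ}
    (m : TorusSite 2 L) (A : TorusSite 2 L → ℂ) (hP : ∀ k : TorusSite 2 L, Commute P (momentumNumber k 0)) :
    (P * ((∑ k : TorusSite 2 L, A k • (momentumAnnihilation (m - k) 1 * momentumAnnihilation k 0))ᴴ *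
        (∑ k : TorusSite 2 L, A k • (momentumAnnihilation (m - k) 1 * momentumAnnihilation k 0)))).trace =
      ∑ k : TorusSite 2 L, ((Complex.normSq (A k) : ℝ) : ℂ) *
        (P * (momentumNumber k 0 * momentumNumber (m - k) 1)).trace := by
  have hct : (∑ k : TorusSite 2 L, A k • (momentumAnnihilation (m - k) 1 * momentumAnnihilation k 0))ᴴ =
      ∑ k : TorusSite 2 L, conj (A k) • (momentumAnnihilation (m - k) 1 * momentumAnnihilation k 0)ᴴ := by
    simp only [conjTranspose_sum, conjTranspose_smul, Complex.star_def]
  rw [hct, Finset.sum_mul_sum, Finset.mul_sum, trace_sum]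
  refine Finset.sum_congr rfl fun k _ => ?_
  rw [Finset.mul_sum, trace_sum, Finset.sum_eq_single_of_mem k (Finset.mem_univ k)]
  · rw [smul_mul_smul_comm, Matrix.mul_smul, trace_smul, conjTranspose_pairModeAt_mul_self,
      smul_eq_mul, Complex.normSq_eq_conj_mul_self]
  · intro k' _ hne
    rw [smul_mul_smul_comm, Matrix.mul_smul, trace_smul,
      trace_mul_conjTranspose_pairModeAt_mul_pairModeAt_of_ne m (Ne.symm hne) (hP k'), smul_zero]

/-- The momentum profile of `Δ_d(m)` is bounded: `|A_m(k)|² ≤ 50` for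
`A_m(k) = Σ_{e ∈ {0} ∪ unitSteps} (g_d(e)/√2)(χ_{m−k}(e) + χ_k(e))` (five steps, `|g_d| ≤ 1`,
`|χ| = 1`). [folklore] -/
theorem normSq_pairModeAtCoeff_dWave_le (m k : TorusSite 2 L) :
    Complex.normSq (∑ e ∈ insert 0 unitSteps, ((dWaveFormFactor e / Real.sqrt 2 : ℝ) : ℂ) *
        (torusChar (m - k) (Torus.proj L e) + torusChar k (Torus.proj L e))) ≤ 50 := by
  have hs : Real.sqrt 2 ^ 2 = 2 := Real.sq_sqrt (by norm_num)
  have hs0 : 0 < Real.sqrt 2 := by positivity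
  -- `|g_d| ≤ 1` (tree: `Theorems.abs_dWaveFormFactor_le_one`, inlined to keep the import cone small)
  have habs : ∀ e : Site 2, |dWaveFormFactor e| ≤ 1 := fun e => by
    unfold dWaveFormFactor
    split_ifs <;> simp
  -- each term has norm ≤ √2
  have hterm : ∀ e : Site 2, ‖((dWaveFormFactor e / Real.sqrt 2 : ℝ) : ℂ) *
      (torusChar (m - k) (Torus.proj L e) + torusChar k (Torus.proj L e))‖ ≤ Real.sqrt 2 := by
    intro e
    rw [norm_mul, Complex.norm_real, Real.norm_eq_abs, abs_div, abs_of_pos hs0]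
    have h1 : ‖torusChar (m - k) (Torus.proj L e) + torusChar k (Torus.proj L e)‖ ≤ 2 := by
      refine (norm_add_le _ _).trans ?_
      rw [norm_torusChar, norm_torusChar]; norm_num
    have h2 : |dWaveFormFactor e| / Real.sqrt 2 ≤ 1 / Real.sqrt 2 :=
      div_le_div_of_nonneg_right (habs e) hs0.le
    calc |dWaveFormFactor e| / Real.sqrt 2 *
          ‖torusChar (m - k) (Torus.proj L e) + torusChar k (Torus.proj L e)‖
        ≤ (1 / Real.sqrt 2) * 2 := mul_le_mul h2 h1 (norm_nonneg _) (by positivity)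
      _ = Real.sqrt 2 := by
          rw [div_mul_eq_mul_div, one_mul, div_eq_iff (ne_of_gt hs0), ← sq, hs]
  -- at most five steps
  have hcard : (insert (0 : Site 2) unitSteps).card ≤ 5 := by
    refine (Finset.card_insert_le _ _).trans ?_
    unfold unitSteps
    refine Nat.succ_le_succ ((Finset.card_insert_le _ _).trans (Nat.succ_le_succ
      ((Finset.card_insert_le _ _).trans (Nat.succ_le_succ
        ((Finset.card_insert_le _ _).trans (Nat.succ_le_succ ?_))))))
    rw [Finset.card_singleton]
  have hnorm : ‖∑ e ∈ insert 0 unitSteps, ((dWaveFormFactor e / Real.sqrt 2 : ℝ) : ℂ) *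
      (torusChar (m - k) (Torus.proj L e) + torusChar k (Torus.proj L e))‖ ≤ 5 * Real.sqrt 2 := by
    refine (norm_sum_le _ _).trans ?_
    calc ∑ e ∈ insert 0 unitSteps, ‖((dWaveFormFactor e / Real.sqrt 2 : ℝ) : ℂ) *
          (torusChar (m - k) (Torus.proj L e) + torusChar k (Torus.proj L e))‖
        ≤ ∑ _e ∈ insert (0 : Site 2) unitSteps, Real.sqrt 2 := Finset.sum_le_sum fun e _ => hterm e
      _ = (insert (0 : Site 2) unitSteps).card * Real.sqrt 2 := by
          rw [Finset.sum_const, nsmul_eq_mul]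
      _ ≤ 5 * Real.sqrt 2 := by
          have : ((insert (0 : Site 2) unitSteps).card : ℝ) ≤ 5 := by exact_mod_cast hcard
          exact mul_le_mul_of_nonneg_right this hs0.le
  rw [Complex.normSq_eq_norm_sq]
  have h0 := norm_nonneg (∑ e ∈ insert 0 unitSteps, ((dWaveFormFactor e / Real.sqrt 2 : ℝ) : ℂ) *
      (torusChar (m - k) (Torus.proj L e) + torusChar k (Torus.proj L e)))
  nlinarith

/-- **Occupation-diagonal states have bounded `d`-wave pair structure factor at every pair momentum.**
For a Hermitian idempotent `P` commuting with every Bloch occupation number `n_{kσ}` of the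
fermionic torus of side `L` and every pair momentum `m`,
`Re tr (P Δ_d(m)† Δ_d(m)) ≤ 50 · L² · Re tr P` (`Δ_d(m) = pairFieldAt dWaveFormFactor L m`; at
`m = 0` compare `re_trace_mul_conjTranspose_pairField_dWave_mul_le` with constant `32`).
Bardeen–Cooper–Schrieffer (1957) §II; Yang (1962) §3. [folklore] -/
theorem re_trace_mul_conjTranspose_pairFieldAt_dWave_mul_le
    {P : Matrix (Finset (Orb (FermionTorus 2 L))) (Finset (Orb (FermionTorus 2 L))) ℂ}
    (hPh : Pᴴ = P) (hPP : P * P = P) (hP : ∀ (k : TorusSite 2 L) (σ : Fin 2), Commute P (momentumNumber k σ))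
    (m : TorusSite 2 L) :
    (P * ((pairFieldAt dWaveFormFactor L m)ᴴ * pairFieldAt dWaveFormFactor L m)).trace.re ≤
      50 * (L : ℝ) ^ 2 * P.trace.re := by
  rw [pairFieldAt_eq_neg_sum_smul_pairModeAt, conjTranspose_neg, neg_mul_neg,
    trace_mul_conjTranspose_sum_smul_pairModeAt_mul m _ (fun k => hP k 0), Complex.re_sum]
  have hterm : ∀ k : TorusSite 2 L,
      (((Complex.normSq (∑ e ∈ insert 0 unitSteps, ((dWaveFormFactor e / Real.sqrt 2 : ℝ) : ℂ) *
          (torusChar (m - k) (Torus.proj L e) + torusChar k (Torus.proj L e))) : ℝ) : ℂ) *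
        (P * (momentumNumber k 0 * momentumNumber (m - k) 1)).trace).re ≤ 50 * P.trace.re := by
    intro k
    rw [Complex.re_ofReal_mul]
    obtain ⟨h0, h1⟩ := re_trace_mul_momentumNumber_up_mul_momentumNumber_down_mem_Icc hPh hPP k
      (m - k) (hP k 0) (hP (m - k) 1)
    have hg := normSq_pairModeAtCoeff_dWave_le m k
    have hg0 := Complex.normSq_nonneg (∑ e ∈ insert 0 unitSteps,
      ((dWaveFormFactor e / Real.sqrt 2 : ℝ) : ℂ) *
        (torusChar (m - k) (Torus.proj L e) + torusChar k (Torus.proj L e)))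
    nlinarith
  calc _ ≤ ∑ _k : TorusSite 2 L, 50 * P.trace.re := Finset.sum_le_sum fun k _ => hterm k
    _ = 50 * (L : ℝ) ^ 2 * P.trace.re := by
        rw [Finset.sum_const, Finset.card_univ, card_torusSite, nsmul_eq_mul]
        push_cast
        ring

end Summit.HubbardSuperconductivity.HubbardSuperconductivity.Theorems.WindowGap.Negative
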